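import Summits.FinalStateConjecture.FinalStateConjecture.Theorems.BartnikGapSettlingGapExhaustionIKStepFrame
import HarnessLib

/-!
# Crux `GapExhaustion` (stmt-FinalStateConjecture-10808), line `photon-shell-pseudoconvexity`:
# stub (UN-6a) `stub_ikFrameNormalisationU` — the EXACT Lorentz frame of a near-Kerr symmetric
# form, with a closeness constant UNIFORM in the Kerr label `(M, a)`

Route `BartnikGapSettling`; helper (`--supports stmt-FinalStateConjecture-10808`) of line lead
c11 (label-uniformity wave 2), the label-uniform twin of the per-label brick
`stub_ikFrameNormalisation` of `BartnikGapSettlingGapExhaustionIKStepFrame.lean`.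

The registered outward Killing sweep S5 quantifies its constants BEFORE the Kerr label `(M, a)`,
so the frame-normalisation constant of Ionescu–Klainerman's chart form (`G p = η` EXACTLY at the
centre of the ball) has to be ONE `δF > 0` for all labels: for every `0 < M`, every `a`, every
symmetric bilinear form `S₀` within `δF` of the Kerr–Schild form `g_{M,a}(x)` at a point with
`r_a(x) > M` is exactly Minkowski in a frame `L` with `‖L‖, ‖L⁻¹‖ ≤ 6`.

Proof: the per-label proof already produces a label-free constant. Read `S₀` in the
Kerr–Schild frame `A_x` (`g_{M,a}(A·, A·) = η`, `Literature/…/KerrSchildFrame.lean`), whose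
operator norms obey `‖A_x‖, ‖A_x⁻¹‖ ≤ 1 + 2|M|/M = 3` on `{r > M}` AT EVERY LABEL; there `S₀`
is `9 δF`-close to `η`, and the near-identity change of frame of `stub_lorentzNormalisation`
(constant `δN`, no label) finishes with `δF := δN / 9`.

References: A. D. Ionescu, S. Klainerman, JAMS 26 (2013), Thm 1.2 [IonescuKlainerman2013]
(the chart form `G p = η` this normalisation serves); R. P. Kerr, A. Schild (1965), §§2–3
[KerrSchild1965] (the Kerr–Schild frame).
-/

noncomputable section

-- instance search through the nested operator types `E4 →L[ℝ] E4 →L[ℝ] ℝ`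
set_option maxSynthPendingDepth 3

-- D-0017: single-problem summit, `Summit.<S>.<S>.…` by design (cf. lakefile `weak.linter.dupNamespace`).
set_option linter.dupNamespace false

namespace Summit.FinalStateConjecture.FinalStateConjecture.Theorems

open Set Function Metric
open Literature.Geometry.Lorentzian
open scoped Manifold ContDiff Topology ENNReal

/-- **Frame normalisation at a point of the star domain, uniformly in the label.** There is
`δF > 0` such that for every `0 < M`, every `a`, every symmetric bilinear form `S₀` on `E4`
within `δF` of the Kerr–Schild form `g_{M,a}(x)` at a point with `r_a(x) > M` is EXACTLY
Minkowski in some frame `L` with `‖L‖, ‖L⁻¹‖ ≤ 6`: `S₀ (L v) (L w) = η(v, w)`. Proof: read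
`S₀` in the Kerr–Schild frame `A_x` (`g_{M,a}(A·, A·) = η`, `‖A_x‖, ‖A_x⁻¹‖ ≤ 3` on `{r > M}` at
every label), then correct by the near-identity change of frame of `stub_lorentzNormalisation`,
whose constant `δN` carries no label; `δF := δN / 9` (linear algebra; it feeds the chart form
`G p = η` of Ionescu–Klainerman's local extension theorem, JAMS 26 (2013), Thm 1.2).
[folklore] -/
theorem stub_ikFrameNormalisationU :
    ∃ δF : ℝ, 0 < δF ∧ ∀ (M a : ℝ), 0 < M →
      ∀ (S₀ : E4 →L[ℝ] E4 →L[ℝ] ℝ) (x : E4), M < Kerr.radius a x →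
        (∀ v w : E4, S₀ v w = S₀ w v) → ‖S₀ - Kerr.bilin M a x‖ ≤ δF →
        ∃ L : E4 ≃L[ℝ] E4, (∀ v w : E4, S₀ (L v) (L w) = Minkowski.bilin v w) ∧
          ‖(L : E4 →L[ℝ] E4)‖ ≤ 6 ∧ ‖(L.symm : E4 →L[ℝ] E4)‖ ≤ 6 := by
  obtain ⟨δN, hδN, hN⟩ := stub_lorentzNormalisation
  refine ⟨δN / 9, by positivity, ?_⟩
  intro M a hM S₀ x hx hS₀ hclose
  have hr0 : 0 < Kerr.radius a x := hM.trans hx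
  have hreg : x ∈ (Kerr.region a M : Set E4) := by
    show max M 0 < Kerr.radius a x
    rw [max_eq_left hM.le]; exact hx
  set A : E4 →L[ℝ] E4 := Kerr.ksFrameInvMap M a x with hAdef
  set B : E4 →L[ℝ] E4 := Kerr.ksFrameMap M a x with hBdef
  have hA3 : ‖A‖ ≤ 3 := by
    have h := Kerr.norm_ksFrameInvMap_le M hM hreg
    have h' : 1 + 2 * |M| / M = 3 := by rw [abs_of_pos hM]; field_simp; ring
    simpa [hAdef, h'] using h
  have hB3 : ‖B‖ ≤ 3 := by
    have h := Kerr.norm_ksFrameMap_le M hM hreg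
    have h' : 1 + 2 * |M| / M = 3 := by rw [abs_of_pos hM]; field_simp; ring
    simpa [hBdef, h'] using h
  obtain ⟨Aeq, hAeq, hAeqs⟩ := ikStep_exists_equiv A B
    (by simpa [hAdef, hBdef] using Kerr.ksFrameInvMap_comp_ksFrameMap M a hr0)
    (by simpa [hAdef, hBdef] using Kerr.ksFrameMap_comp_ksFrameInvMap M a hr0)
  -- `S₀` read in the Kerr–Schild frame
  set S : E4 →L[ℝ] E4 →L[ℝ] ℝ := S₀.bilinearComp A A with hSdef
  have hSsym : ∀ v w : E4, S v w = S w v := fun v w ↦ by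
    simp only [hSdef, ContinuousLinearMap.bilinearComp_apply, hS₀ (A v) (A w)]
  have hSclose : ‖S - Minkowski.bilin‖ ≤ δN := by
    obtain ⟨Bc, hBc, hBcG⟩ := compAffine_exists_bilinearCompCLM A
    have hdiff : S - Minkowski.bilin = Bc (S₀ - Kerr.bilin M a x) := by
      rw [map_sub, hBcG, hBcG]
      ext v w
      simp only [hSdef, sub_apply, ContinuousLinearMap.bilinearComp_apply,
        hAdef, Kerr.bilin_ksFrameInvMap M a hr0]
    rw [hdiff]
    calc ‖Bc (S₀ - Kerr.bilin M a x)‖ ≤ ‖Bc‖ * ‖S₀ - Kerr.bilin M a x‖ := Bc.le_opNorm _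
      _ ≤ (‖A‖ * ‖A‖) * (δN / 9) := by gcongr
      _ ≤ (3 * 3) * (δN / 9) := by gcongr
      _ = δN := by ring
  obtain ⟨C, hC, hC2, hCs2⟩ := hN S hSsym hSclose
  refine ⟨C.trans Aeq, fun v w ↦ ?_, ?_, ?_⟩
  · have h := hC v w
    simp only [hSdef, ContinuousLinearMap.bilinearComp_apply] at h
    simpa [ContinuousLinearEquiv.trans_apply, ← hAeq] using h
  · refine ContinuousLinearMap.opNorm_le_bound _ (by norm_num) fun v ↦ ?_
    have h1 : (C.trans Aeq : E4 →L[ℝ] E4) v = A (C v) := by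
      simp [ContinuousLinearEquiv.trans_apply, ← hAeq]
    rw [h1]
    calc ‖A (C v)‖ ≤ ‖A‖ * ‖(C : E4 →L[ℝ] E4) v‖ := A.le_opNorm _
      _ ≤ ‖A‖ * (‖(C : E4 →L[ℝ] E4)‖ * ‖v‖) := by gcongr; exact (C : E4 →L[ℝ] E4).le_opNorm v
      _ ≤ 3 * (2 * ‖v‖) := by gcongr
      _ = 6 * ‖v‖ := by ring
  · refine ContinuousLinearMap.opNorm_le_bound _ (by norm_num) fun v ↦ ?_
    have h1 : ((C.trans Aeq).symm : E4 →L[ℝ] E4) v = (C.symm : E4 →L[ℝ] E4) (B v) := by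
      simp [ContinuousLinearEquiv.symm_trans_apply, ← hAeqs]
    rw [h1]
    calc ‖(C.symm : E4 →L[ℝ] E4) (B v)‖ ≤ ‖(C.symm : E4 →L[ℝ] E4)‖ * ‖B v‖ :=
          (C.symm : E4 →L[ℝ] E4).le_opNorm _
      _ ≤ ‖(C.symm : E4 →L[ℝ] E4)‖ * (‖B‖ * ‖v‖) := by gcongr; exact B.le_opNorm v
      _ ≤ 2 * (3 * ‖v‖) := by gcongr
      _ = 6 * ‖v‖ := by ring

/-- The per-label form recovered from the uniform one: for `0 < M` there is `δF > 0` (the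
label-free constant of `stub_ikFrameNormalisationU`) normalising every symmetric form `δF`-close
to `g_{M,a}(x)`, `r_a(x) > M`, to Minkowski in a frame of norms `≤ 6`. [folklore] -/
theorem stub_ikFrameNormalisationU_perLabel (M a : ℝ) (hM : 0 < M) :
    ∃ δF : ℝ, 0 < δF ∧
      ∀ (S₀ : E4 →L[ℝ] E4 →L[ℝ] ℝ) (x : E4), M < Kerr.radius a x →
        (∀ v w : E4, S₀ v w = S₀ w v) → ‖S₀ - Kerr.bilin M a x‖ ≤ δF →
        ∃ L : E4 ≃L[ℝ] E4, (∀ v w : E4, S₀ (L v) (L w) = Minkowski.bilin v w) ∧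
          ‖(L : E4 →L[ℝ] E4)‖ ≤ 6 ∧ ‖(L.symm : E4 →L[ℝ] E4)‖ ≤ 6 := by
  obtain ⟨δF, hδF, h⟩ := stub_ikFrameNormalisationU
  exact ⟨δF, hδF, h M a hM⟩

end Summit.FinalStateConjecture.FinalStateConjecture.Theorems

end
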